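import Literature.MathematicalPhysics.QuantumLattice.HeisenbergOrderMerminWagnerTorusProofs
import Literature.MathematicalPhysics.QuantumLattice.HubbardHubbardModelProofs
import Literature.MathematicalPhysics.QuantumLattice.HeisenbergModelGlobalRotationProofs
import Literature.MathematicalPhysics.QuantumLattice.HeisenbergOrder
import HarnessLib

/-!
# Mermin–Wagner for general interactions, III: test functions, `SU(2)` reduction, and the discharge

Topic `MathematicalPhysics/QuantumLattice`; third of three sibling PROOF files of `HeisenbergOrder.lean`.
It DISCHARGES the named fact `Literature.MathematicalPhysics.QuantumLattice.mermin_wagner_general`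
(hubbard.S12, general interactions):

`theorem mermin_wagner_general_holds : mermin_wagner_general` — for `d ∈ {1, 2}`, every spin `n/2`,
every Hermitian, finite-range, bounded, rotation-invariant lattice interaction `Φ` and every `β > 0`,
the torus Gibbs states have no long-range order of the spin–spin correlation
`spinSpinCorrTorusOf β Φ L x y = Σ_α re ⟨Ŝ^α_x Ŝ^α_y⟩_{β,L}` (`¬ HasTorusLRO`).

Route (module docstring of `HeisenbergOrderMerminWagnerGaugeProofs`): the finite-volume
Koma–Tasaki / Ito (McBryan–Spencer) power-law bound for rotation-invariant quantum spin systems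
(Koma–Tasaki, PRL 68 (1992) 3248, Theorem eq. (4) and note [11]) followed by the summation lemma
`not_hasTorusLRO_of_abs_le_rpow`; the infinite-volume theorem of Klein–Landau–Shucker (1981) cited by
the fact is not needed for the tree's finite-volume statement. Theorems only; no definition, no named
fact, no statement is introduced or changed.

## Contents

* `exists_testFunction_range` (P1, P2 of the source for a general range `ρ`, `d = 1, 2` at once): the
  logarithmic McBryan–Spencer profile `ψ (u) = q log (min (dist (u, y), R₀) + 1)` has
  `ψ x - ψ y = q log (R₀ + 1)` and energy `Σ_u Σ_v [dist ≤ ρ] (cosh (m (ψ u - ψ v)) - 1) ≤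
  16 (2ρ+1)^d (mρ)² q² (log (R₀ + 1) + 1)`; `le_rpow_of_forall_testFunction_range` (eqs. (12)–(13)):
  the choice of the charge `q`, giving `A₀ e (dist + 1)^{-f}`;
* spin algebra: `Ŝˣ = ½(Ŝ⁺ + Ŝ⁻)`, `Ŝʸ = (Ŝ⁺ - Ŝ⁻)/(2i)`, the four-term bounds for `ω(Ŝˣ_x Ŝˣ_y)`,
  `ω(Ŝʸ_x Ŝʸ_y)`, the `SU(2)` reduction `⟨Ŝᶻ_x Ŝᶻ_y⟩ = ⟨Ŝˣ_x Ŝˣ_y⟩` (global `π/2` rotation about the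
  `2`-axis, `ProductOperators`, `spinRotation_y_conj_spinZ`), and `‖𝟙 ⊗ a ⊗ 𝟙‖ = ‖a‖`;
* `exists_abs_spinSpinCorrTorusOf_le_rpow`: `|Σ_α ⟨Ŝ^α_x Ŝ^α_y⟩_{β,L}| ≤ C' (dist + 1)^{-f}` with
  `f > 0`, `C'` independent of `L, x, y` (the mixed correlations `⟨Ŝ^±_x Ŝ^∓_y⟩` decay by the profile,
  the equal-sign ones vanish by constant profiles); and the discharge `mermin_wagner_general_holds`.

## Sources

* T. Koma, H. Tasaki, PRL **68** (1992) 3248 = arXiv:cond-mat/9709068: Theorem, eqs. (4), (12)–(13),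
  properties P1–P2, note [11], and the remark after the Theorem (decay bounds "rule out ... the
  corresponding magnetic ordering").
* K. R. Ito, J. Stat. Phys. **29** (1982) 747; O. A. McBryan, T. Spencer, Comm. Math. Phys. **53**
  (1977) 299 (the logarithmic test function).
* A. Klein, L. J. Landau, D. S. Shucker, J. Stat. Phys. **26** (1981) 505 (infinite-volume form).
* H. Tasaki, *Physics and Mathematics of Quantum Many-Body Systems* (2020), §2.1–2.2 (spin algebra,
  global rotations).
-/

noncomputable section

open Matrix Complex Finset
open scoped Matrix.Norms.L2Operator ComplexOrder

namespace Literature.MathematicalPhysics.QuantumLattice.MerminWagner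

open Literature.MathematicalPhysics.QuantumLattice

variable {Λ : Type*} [Fintype Λ] [DecidableEq Λ] {n : ℕ}


/-! ### McBryan–Spencer test functions for a general range (`d = 1, 2` uniformly) -/

section TestFunction

open Literature.Probability.LatticeModels

variable {d : ℕ} {L : ℕ} [NeZero L]

omit [NeZero L] in
/-- For naturals `a, b` with `|a - b| ≤ k`, `|log (a + 1) - log (b + 1)| ≤ k / (min a b + 1)`
(`log t ≤ t - 1`). McBryan–Spencer, Comm. Math. Phys. 53 (1977) 299. [folklore] -/
theorem abs_log_succ_sub_log_succ_le_div (a b k : ℕ) (hab : a ≤ b + k) (hba : b ≤ a + k) :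
    |Real.log (a + 1) - Real.log (b + 1)| ≤ k / (min a b + 1) := by
  wlog h : a ≤ b generalizing a b
  · rw [abs_sub_comm, min_comm]
    exact this b a hba hab (le_of_not_ge h)
  rw [min_eq_left h]
  have ha : (0 : ℝ) < a + 1 := by positivity
  have hb : (0 : ℝ) < b + 1 := by positivity
  rw [abs_sub_comm, abs_of_nonneg (by
      rw [sub_nonneg]; exact Real.log_le_log ha (by exact_mod_cast Nat.succ_le_succ h)),
    ← Real.log_div hb.ne' ha.ne']
  calc _ ≤ (b + 1 : ℝ) / (a + 1) - 1 := Real.log_le_sub_one_of_pos (by positivity)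
    _ ≤ k / (a + 1) := by
        rw [div_sub_one ha.ne', div_le_div_iff_of_pos_right ha]
        have : (b : ℝ) ≤ a + k := by exact_mod_cast hba
        linarith

omit [NeZero L] in
/-- The sphere counts in dimensions `d = 1, 2` are both bounded by `4 (2r + 1)`. [folklore] -/
theorem sphere_const_le_of_le_two (hd : 0 < d) (hd2 : d ≤ 2) (r : ℕ) :
    d * (2 * (2 * r + 1) ^ (d - 1)) ≤ 4 * (2 * r + 1) := by
  interval_cases d <;> simp <;> omega

/-- **McBryan–Spencer test function for a finite range** (uniform in `L`, dimensions `1` and `2`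
at once). For `x, y ∈ (ℤ/Lℤ)^d` at periodic distance `R₀`, a range `ρ`, a multiplier `m` and a
charge `q ≥ 0` with `q m ρ ≤ 1`, the profile `ψ (u) = q log (min (dist (u, y), R₀) + 1)` has
`ψ x - ψ y = q log (R₀ + 1)` and
`Σ_u Σ_v [dist (u, v) ≤ ρ] (cosh (m (ψ u - ψ v)) - 1) ≤ 16 (2ρ + 1)^d (m ρ)² q² (log (R₀ + 1) + 1)`:
for `dist (u, v) ≤ ρ`, `|ψ u - ψ v| ≤ q ρ / (min + 1)`, so `cosh - 1 ≤ (m q ρ)² (dist + 1)⁻²` at the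
endpoint closer to `y` (and `0` outside the ball of radius `R₀`); each site has `≤ (2ρ + 1)^d`
partners, and the radial sum is `≤ 8 (log (R₀ + 1) + 1)` (`#sphere(r) ≤ 4 (2r + 1)` for `d ≤ 2`).
McBryan–Spencer, Comm. Math. Phys. 53 (1977) 299; Koma–Tasaki, PRL 68 (1992) 3248, P1, P2 after
eq. (11). [cite: KomaTasakiPRL1992, properties P1 and P2 after eq. (11)] -/
theorem exists_testFunction_range (hd : 0 < d) (hd2 : d ≤ 2) (x y : TorusSite d L) (ρ m : ℕ)
    {q : ℝ} (hq0 : 0 ≤ q) (hq1 : q * (m * ρ) ≤ 1) :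
    ∃ ψ : TorusSite d L → ℝ,
      ψ x - ψ y = q * Real.log (torusDist x y + 1) ∧
      ∑ u, ∑ v, (if torusDist u v ≤ ρ then Real.cosh (m * (ψ u - ψ v)) - 1 else 0) ≤
        16 * (2 * ρ + 1) ^ d * (m * ρ) ^ 2 * q ^ 2 * (Real.log (torusDist x y + 1) + 1) := by
  set R₀ : ℕ := torusDist x y with hR₀
  set μ : TorusSite d L → ℕ := fun u => min (torusDist u y) R₀ with hμ
  refine ⟨fun u => q * Real.log (μ u + 1), ?_, ?_⟩
  · have hx : μ x = R₀ := by simp [hμ, hR₀]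
    have hy : μ y = 0 := by simp [hμ]
    show q * Real.log (μ x + 1) - q * Real.log (μ y + 1) = _
    rw [hx, hy]
    simp
  · -- the comparison function
    set g : TorusSite d L → ℝ := fun u =>
      if torusDist u y < R₀ then 1 / ((torusDist u y : ℝ) + 1) ^ 2 else 0 with hg
    have hg0 : ∀ u, 0 ≤ g u := fun u => by
      simp only [hg]; split_ifs <;> positivity
    set K : ℝ := ((m : ℝ) * ρ) ^ 2 * q ^ 2 with hK
    have hK0 : 0 ≤ K := by positivity
    -- `μ` is `ρ`-Lipschitz on pairs at distance `≤ ρ`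
    have hlip : ∀ u v, torusDist u v ≤ ρ → μ u ≤ μ v + ρ ∧ μ v ≤ μ u + ρ := by
      intro u v huv
      have h1 : torusDist u y ≤ torusDist u v + torusDist v y := torusDist_triangle' u v y
      have h2 : torusDist v y ≤ torusDist v u + torusDist u y := torusDist_triangle' v u y
      rw [torusDist_comm' v u] at h2
      simp only [hμ]
      constructor <;> omega
    have hkey : ∀ u v, torusDist u v ≤ ρ →
        Real.cosh (m * (q * Real.log (μ u + 1) - q * Real.log (μ v + 1))) - 1 ≤
          K * g u + K * g v := by
      intro u v huv
      obtain ⟨h1, h2⟩ := hlip u v huv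
      rcases eq_or_ne (μ u) (μ v) with heq | hne
      · rw [heq, sub_self, mul_zero, Real.cosh_zero, sub_self]
        have := hg0 u; have := hg0 v; positivity
      · have hmin0 : (0 : ℝ) ≤ min (μ u) (μ v) := by positivity
        have hdiff : |q * Real.log (μ u + 1) - q * Real.log (μ v + 1)| ≤
            q * (ρ / (min (μ u) (μ v) + 1)) := by
          rw [← mul_sub, abs_mul, abs_of_nonneg hq0]
          exact mul_le_mul_of_nonneg_left (abs_log_succ_sub_log_succ_le_div _ _ ρ h1 h2) hq0
        have hs : |(m : ℝ) * (q * Real.log (μ u + 1) - q * Real.log (μ v + 1))| ≤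
            (m * ρ) * q / (min (μ u) (μ v) + 1) := by
          rw [abs_mul, Nat.abs_cast]
          calc (m : ℝ) * |q * Real.log (μ u + 1) - q * Real.log (μ v + 1)|
              ≤ m * (q * (ρ / (min (μ u) (μ v) + 1))) :=
                mul_le_mul_of_nonneg_left hdiff (Nat.cast_nonneg m)
            _ = (m * ρ) * q / (min (μ u) (μ v) + 1) := by ring
        have hle1 : |(m : ℝ) * (q * Real.log (μ u + 1) - q * Real.log (μ v + 1))| ≤ 1 := by
          refine hs.trans ?_
          rw [div_le_one (by positivity)]
          nlinarith
        have hsq : ((m : ℝ) * (q * Real.log (μ u + 1) - q * Real.log (μ v + 1))) ^ 2 ≤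
            ((m * ρ) * q / (min (μ u) (μ v) + 1)) ^ 2 := sq_le_sq' (abs_le.mp hs).1 (abs_le.mp hs).2
        refine (cosh_sub_one_le_sq hle1).trans (hsq.trans ?_)
        rcases Nat.lt_or_gt_of_ne hne with hlt | hlt
        · have hmu : μ u < R₀ := lt_of_lt_of_le hlt (min_le_right _ _)
          have hdu : torusDist u y < R₀ := by
            by_contra hc
            have : μ u = R₀ := by simp only [hμ]; exact min_eq_right (not_lt.mp hc)
            omega
          have hmu' : μ u = torusDist u y := by simp only [hμ]; exact min_eq_left hdu.le
          have hgu : g u = 1 / ((torusDist u y : ℝ) + 1) ^ 2 := by simp only [hg, if_pos hdu]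
          rw [min_eq_left hlt.le, hmu']
          calc ((m : ℝ) * ρ * q / ((torusDist u y : ℕ) + 1 : ℝ)) ^ 2 = K * g u := by
                rw [hgu, hK, div_pow, one_div, div_eq_mul_inv, mul_pow]
            _ ≤ K * g u + K * g v := le_add_of_nonneg_right (mul_nonneg hK0 (hg0 v))
        · have hmv : μ v < R₀ := lt_of_lt_of_le hlt (min_le_right _ _)
          have hdv : torusDist v y < R₀ := by
            by_contra hc
            have : μ v = R₀ := by simp only [hμ]; exact min_eq_right (not_lt.mp hc)
            omega
          have hmv' : μ v = torusDist v y := by simp only [hμ]; exact min_eq_left hdv.le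
          have hgv : g v = 1 / ((torusDist v y : ℝ) + 1) ^ 2 := by simp only [hg, if_pos hdv]
          rw [min_eq_right hlt.le, hmv']
          calc ((m : ℝ) * ρ * q / ((torusDist v y : ℕ) + 1 : ℝ)) ^ 2 = K * g v := by
                rw [hgv, hK, div_pow, one_div, div_eq_mul_inv, mul_pow]
            _ ≤ K * g u + K * g v := le_add_of_nonneg_left (mul_nonneg hK0 (hg0 u))
    -- symmetrise: each site has at most `(2ρ+1)^d` partners
    have hball : ∀ u : TorusSite d L,
        ((univ.filter fun v : TorusSite d L => torusDist u v ≤ ρ).card : ℝ) ≤ (2 * ρ + 1) ^ d := by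
      intro u
      exact_mod_cast card_filter_torusDist_le L u ρ
    have hsym : ∑ u, ∑ v, (if torusDist u v ≤ ρ then
        Real.cosh (m * (q * Real.log (μ u + 1) - q * Real.log (μ v + 1))) - 1 else 0) ≤
        2 * (2 * ρ + 1) ^ d * ∑ u, K * g u := by
      calc ∑ u, ∑ v, (if torusDist u v ≤ ρ then
            Real.cosh (m * (q * Real.log (μ u + 1) - q * Real.log (μ v + 1))) - 1 else 0)
          ≤ ∑ u, ∑ v, ((if torusDist u v ≤ ρ then K * g u else 0) +
              (if torusDist u v ≤ ρ then K * g v else 0)) := by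
            refine sum_le_sum fun u _ => sum_le_sum fun v _ => ?_
            split_ifs with huv
            · simpa using hkey u v huv
            · simp
        _ = ∑ u, ∑ v, (if torusDist u v ≤ ρ then K * g u else 0) +
              ∑ u, ∑ v, (if torusDist u v ≤ ρ then K * g v else 0) := by
            rw [← sum_add_distrib]
            exact sum_congr rfl fun u _ => sum_add_distrib
        _ ≤ ∑ u, (2 * ρ + 1) ^ d * (K * g u) + ∑ v, (2 * ρ + 1) ^ d * (K * g v) := by
            refine add_le_add (sum_le_sum fun u _ => ?_) ?_
            · rw [← sum_filter, sum_const, nsmul_eq_mul]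
              exact mul_le_mul_of_nonneg_right (hball u) (mul_nonneg hK0 (hg0 u))
            · rw [sum_comm]
              refine sum_le_sum fun v _ => ?_
              rw [← sum_filter, sum_const, nsmul_eq_mul]
              refine mul_le_mul_of_nonneg_right ?_ (mul_nonneg hK0 (hg0 v))
              have hset : (univ.filter fun u : TorusSite d L => torusDist u v ≤ ρ) =
                  univ.filter fun u : TorusSite d L => torusDist v u ≤ ρ := by
                refine Finset.filter_congr fun u _ => ?_
                rw [torusDist_comm']
              rw [hset]
              exact hball v
        _ = 2 * (2 * ρ + 1) ^ d * ∑ u, K * g u := by rw [← mul_sum, ← mul_sum]; ring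
    -- radial summation
    set F : ℕ → ℝ := fun r => if r < R₀ then 1 / ((r : ℝ) + 1) ^ 2 else 0 with hF
    have hF0 : ∀ r, 0 ≤ F r := fun r => by simp only [hF]; split_ifs <;> positivity
    have hgF : ∀ u, g u = F (torusDist u y) := fun u => rfl
    have hrad := sum_radial_le (d := d) F hF0 y (card_filter_torusDist_eq_le hd y)
      (fun u => torusDist_lt u y)
    have hterm : ∀ r, ((d * (2 * (2 * r + 1) ^ (d - 1)) : ℕ) : ℝ) * F r ≤
        8 * (if r < R₀ then 1 / ((r : ℝ) + 1) else 0) := by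
      intro r
      have hsph : ((d * (2 * (2 * r + 1) ^ (d - 1)) : ℕ) : ℝ) ≤ 4 * (2 * r + 1) := by
        exact_mod_cast sphere_const_le_of_le_two hd hd2 r
      simp only [hF]
      split_ifs with hr
      · have hr1 : (0 : ℝ) < r + 1 := by positivity
        calc ((d * (2 * (2 * r + 1) ^ (d - 1)) : ℕ) : ℝ) * (1 / ((r : ℝ) + 1) ^ 2)
            ≤ (4 * (2 * r + 1)) * (1 / ((r : ℝ) + 1) ^ 2) :=
              mul_le_mul_of_nonneg_right hsph (by positivity)
          _ ≤ 8 * (1 / ((r : ℝ) + 1)) := by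
              rw [mul_one_div, mul_one_div, div_le_div_iff₀ (by positivity) hr1]
              nlinarith
      · simp
    have hharm : ∑ r ∈ range L, (if r < R₀ then 1 / ((r : ℝ) + 1) else 0) ≤
        Real.log (R₀ + 1) + 1 := by
      rw [← sum_filter, show (range L).filter (fun r => r < R₀) = range R₀ by
        ext r; simp only [mem_filter, mem_range]; have := torusDist_lt x y; omega]
      have h1 : (∑ r ∈ range R₀, 1 / ((r : ℝ) + 1)) = (harmonic R₀ : ℝ) := by
        simp only [harmonic, Rat.cast_sum, Rat.cast_inv, Nat.cast_add,
          Nat.cast_one, one_div]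
        push_cast; rfl
      have h2 : (harmonic R₀ : ℝ) ≤ harmonic (R₀ + 1) := by
        rw [harmonic_succ]; push_cast
        have : (0 : ℝ) ≤ ((R₀ : ℝ) + 1)⁻¹ := by positivity
        linarith
      have h3 := harmonic_le_one_add_log (R₀ + 1)
      push_cast at h3
      linarith
    have hsumg : ∑ u, K * g u ≤ K * (8 * (Real.log (R₀ + 1) + 1)) := by
      rw [← mul_sum]
      refine mul_le_mul_of_nonneg_left ?_ hK0
      calc ∑ u, g u = ∑ u, F (torusDist u y) := by simp only [hgF]
        _ ≤ ∑ r ∈ range L, ((d * (2 * (2 * r + 1) ^ (d - 1)) : ℕ) : ℝ) * F r := hrad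
        _ ≤ ∑ r ∈ range L, 8 * (if r < R₀ then 1 / ((r : ℝ) + 1) else 0) := sum_le_sum fun r _ => hterm r
        _ = 8 * ∑ r ∈ range L, (if r < R₀ then 1 / ((r : ℝ) + 1) else 0) := by rw [← mul_sum]
        _ ≤ 8 * (Real.log (R₀ + 1) + 1) := by gcongr
    calc _ ≤ 2 * (2 * ρ + 1) ^ d * ∑ u, K * g u := hsym
      _ ≤ 2 * (2 * ρ + 1) ^ d * (K * (8 * (Real.log (R₀ + 1) + 1))) :=
          mul_le_mul_of_nonneg_left hsumg (by positivity)
      _ = _ := by rw [hK]; ring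


/-- **Power-law decay from the finite-range test-function bound.** If `a` obeys
`a ≤ A₀ e^{-(ψ x - ψ y)} exp [b Σ_u Σ_v [dist ≤ ρ] (cosh (m (ψ u - ψ v)) - 1)]` for every real `ψ` on
`(ℤ/Lℤ)^d` (`d ∈ {1, 2}`, `b, A₀ ≥ 0`), then `a ≤ A₀ · e · (dist (x, y) + 1)^{-f}` with
`f = 1 / (2 (2 b K₂ + m ρ + 1))`, `K₂ = 16 (2ρ+1)^d (m ρ)²`: take the profile of
`exists_testFunction_range` with charge `q = 1/(2 b K₂ + m ρ + 1)`, so that the exponent is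
`≤ -q ℓ + b K₂ q² (ℓ + 1) ≤ -q ℓ / 2 + 1`, `ℓ = log (dist + 1)`. Koma–Tasaki, PRL 68 (1992) 3248,
eqs. (12)–(13) and P2. [cite: KomaTasakiPRL1992, eqs. (12)–(13)] -/
theorem le_rpow_of_forall_testFunction_range (hd : 0 < d) (hd2 : d ≤ 2) (x y : TorusSite d L)
    (ρ m : ℕ) {b A₀ : ℝ} (hb : 0 ≤ b) (hA₀ : 0 ≤ A₀) {a : ℝ}
    (h : ∀ ψ : TorusSite d L → ℝ, a ≤ A₀ * Real.exp (-(ψ x - ψ y)) * Real.exp (b *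
      ∑ u, ∑ v, (if torusDist u v ≤ ρ then Real.cosh (m * (ψ u - ψ v)) - 1 else 0))) :
    a ≤ A₀ * Real.exp 1 * ((torusDist x y : ℝ) + 1) ^
      (-(1 / (2 * (2 * b * (16 * (2 * ρ + 1) ^ d * (m * ρ) ^ 2) + m * ρ + 1)))) := by
  set K₂ : ℝ := 16 * (2 * ρ + 1) ^ d * (m * ρ) ^ 2 with hK₂
  have hK₂0 : 0 ≤ K₂ := by positivity
  have hmρ : (0 : ℝ) ≤ m * ρ := by positivity
  set c : ℝ := 2 * b * K₂ + m * ρ with hc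
  have hc0 : 0 ≤ c := by positivity
  set q : ℝ := 1 / (c + 1) with hq
  have hq0 : 0 < q := by positivity
  have hqc1 : q * (c + 1) = 1 := by rw [hq]; field_simp
  have hq1 : q ≤ 1 := by nlinarith
  have hqm : q * (m * ρ) ≤ 1 := by nlinarith [mul_nonneg hq0.le (mul_nonneg (mul_nonneg two_pos.le hb) hK₂0)]
  have hbq : 2 * b * K₂ * q ≤ 1 := by nlinarith [mul_nonneg hq0.le hmρ]
  have hf : 1 / (2 * (c + 1)) = q / 2 := by rw [hq]; field_simp
  obtain ⟨ψ, hψ, hE⟩ := exists_testFunction_range hd hd2 x y ρ m hq0.le hqm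
  set ℓ : ℝ := Real.log (torusDist x y + 1) with hℓ
  have hℓ0 : 0 ≤ ℓ := Real.log_nonneg (by simp)
  set E : ℝ := ∑ u, ∑ v, (if torusDist u v ≤ ρ then Real.cosh (m * (ψ u - ψ v)) - 1 else 0) with hEdef
  refine (h ψ).trans ?_
  rw [hf, hψ, Real.rpow_def_of_pos (by positivity), mul_assoc, ← Real.exp_add, mul_assoc,
    ← Real.exp_add]
  refine mul_le_mul_of_nonneg_left (Real.exp_le_exp.mpr ?_) hA₀
  have hE' : b * E ≤ b * (K₂ * q ^ 2 * (ℓ + 1)) := by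
    refine mul_le_mul_of_nonneg_left ?_ hb
    calc E ≤ 16 * (2 * ρ + 1) ^ d * (m * ρ) ^ 2 * q ^ 2 * (ℓ + 1) := hE
      _ = K₂ * q ^ 2 * (ℓ + 1) := by rw [hK₂]
  have h1 : b * K₂ * q ^ 2 * ℓ ≤ q * ℓ / 2 := by
    have := mul_le_mul_of_nonneg_right hbq (mul_nonneg hq0.le hℓ0)
    nlinarith
  have h2 : b * K₂ * q ^ 2 ≤ 1 / 2 := by nlinarith
  nlinarith

end TestFunction

/-! ### Spin components in terms of raising and lowering operators; rotating `Ŝᶻ` into `Ŝˣ` -/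

section SpinAlgebra

/-- `Ŝˣ_x = ½ (Ŝ⁺_x + Ŝ⁻_x)`. Tasaki (2020) §2.1, eq. (2.1.6). [folklore] -/
theorem siteSpin_zero_eq (x : Λ) : (siteSpin n x 0 : Op Λ (n + 1)) =
    (1 / 2 : ℂ) • (onSite x (spinRaise n) + onSite x (spinLower n)) := by
  rw [siteSpin, spinVec_zero, spinX, onSite_smul', onSite_add']

/-- `Ŝʸ_x = (Ŝ⁺_x - Ŝ⁻_x) / (2i)`. Tasaki (2020) §2.1, eq. (2.1.6). [folklore] -/
theorem siteSpin_one_eq (x : Λ) : (siteSpin n x 1 : Op Λ (n + 1)) =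
    (1 / (2 * I) : ℂ) • (onSite x (spinRaise n) - onSite x (spinLower n)) := by
  rw [siteSpin, spinVec_one, spinY, onSite_smul', onSite_sub']

/-- Four-term bound for `ω(Ŝˣ_x Ŝˣ_y)` by the raising/lowering correlations, for any linear
functional `ω`: `|ω(Ŝˣ_x Ŝˣ_y)| ≤ ¼ Σ_{ε,ε'} |ω(Ŝ^ε_x Ŝ^{ε'}_y)|`. [folklore] -/
theorem norm_map_siteSpin_zero_mul_le (ω : Op Λ (n + 1) →ₗ[ℂ] ℂ) (x y : Λ) :
    ‖ω (siteSpin n x 0 * siteSpin n y 0)‖ ≤ (1 / 4) *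
      (‖ω (onSite x (spinRaise n) * onSite y (spinRaise n))‖ +
        ‖ω (onSite x (spinRaise n) * onSite y (spinLower n))‖ +
        ‖ω (onSite x (spinLower n) * onSite y (spinRaise n))‖ +
        ‖ω (onSite x (spinLower n) * onSite y (spinLower n))‖) := by
  rw [siteSpin_zero_eq, siteSpin_zero_eq, smul_mul_smul_comm, map_smul, norm_smul, add_mul, mul_add,
    mul_add, map_add, map_add, map_add]
  have hc : ‖(1 / 2 * (1 / 2) : ℂ)‖ = 1 / 4 := by norm_num
  rw [hc]
  refine mul_le_mul_of_nonneg_left ?_ (by norm_num)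
  refine (norm_add_le _ _).trans ?_
  refine (add_le_add (norm_add_le _ _) (norm_add_le _ _)).trans (le_of_eq ?_)
  ring

/-- Four-term bound for `ω(Ŝʸ_x Ŝʸ_y)` by the raising/lowering correlations. [folklore] -/
theorem norm_map_siteSpin_one_mul_le (ω : Op Λ (n + 1) →ₗ[ℂ] ℂ) (x y : Λ) :
    ‖ω (siteSpin n x 1 * siteSpin n y 1)‖ ≤ (1 / 4) *
      (‖ω (onSite x (spinRaise n) * onSite y (spinRaise n))‖ +
        ‖ω (onSite x (spinRaise n) * onSite y (spinLower n))‖ +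
        ‖ω (onSite x (spinLower n) * onSite y (spinRaise n))‖ +
        ‖ω (onSite x (spinLower n) * onSite y (spinLower n))‖) := by
  rw [siteSpin_one_eq, siteSpin_one_eq, smul_mul_smul_comm, map_smul, norm_smul, sub_mul, mul_sub,
    mul_sub, map_sub, map_sub, map_sub]
  have hc : ‖(1 / (2 * I) * (1 / (2 * I)) : ℂ)‖ = 1 / 4 := by
    rw [norm_mul, norm_div, norm_mul, norm_one, Complex.norm_two, Complex.norm_I]
    norm_num
  rw [hc]
  refine mul_le_mul_of_nonneg_left ?_ (by norm_num)
  refine (norm_sub_le _ _).trans ?_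
  refine (add_le_add (norm_sub_le _ _) (norm_sub_le _ _)).trans (le_of_eq ?_)
  ring

/-- **`SU(2)` symmetry of the Gibbs state turns `⟨Ŝᶻ_x Ŝᶻ_y⟩` into `⟨Ŝˣ_x Ŝˣ_y⟩`**: for a
Hamiltonian commuting with the total spin, the Gibbs weight commutes with the global `π/2`
rotation `V` about the `2`-axis (`V Ŝᶻ_u Vᴴ = Ŝˣ_u` at every site), and the trace is invariant.
Tasaki (2020) §2.2, eq. (2.2.13); Bratteli–Robinson II §5.3.1. [folklore] -/
theorem gibbsState_siteSpin_two_mul_eq {H : Op Λ (n + 1)} (hH : ∀ α, Commute H (totalSpin n α))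
    (β : ℝ) (x y : Λ) :
    gibbsState β H (siteSpin n x 2 * siteSpin n y 2) = gibbsState β H (siteSpin n x 0 * siteSpin n y 0) := by
  have hu : spinRotation n (Pi.single 1 (Real.pi / 2)) * (spinRotation n (Pi.single 1 (Real.pi / 2)))ᴴ = 1 :=
    spinRotation_y_mul_conjTranspose n
  have hu' : (spinRotation n (Pi.single 1 (Real.pi / 2)))ᴴ * spinRotation n (Pi.single 1 (Real.pi / 2)) = 1 :=
    spinRotation_y_conjTranspose_mul n
  have hVS : ∀ z : Λ, productOp (fun _ : Λ => spinRotation n (Pi.single 1 (Real.pi / 2))) *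
      siteSpin n z 2 * (productOp (fun _ : Λ => spinRotation n (Pi.single 1 (Real.pi / 2))))ᴴ =
      (siteSpin n z 0 : Op Λ (n + 1)) := by
    intro z
    rw [productOp_conj_siteSpin (fun _ => hu), spinVec_two, spinRotation_y_conj_spinZ, siteSpin,
      spinVec_zero]
  have hVV : (productOp (fun _ : Λ => spinRotation n (Pi.single 1 (Real.pi / 2))))ᴴ *
      productOp (fun _ : Λ => spinRotation n (Pi.single 1 (Real.pi / 2))) = 1 :=
    productOp_conjTranspose_mul (fun _ => hu')
  have hHV : Commute H (productOp (fun _ : Λ => spinRotation n (Pi.single 1 (Real.pi / 2)))) := by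
    rw [← globalRotation_eq_productOp]
    exact commute_globalRotation_of_commute_totalSpin hH _
  have hEV : Commute (gibbsWeight β H) (productOp (fun _ : Λ => spinRotation n (Pi.single 1 (Real.pi / 2)))) :=
    (hHV.smul_left (-(β : ℂ))).exp_left
  have hprod : (siteSpin n x 0 * siteSpin n y 0 : Op Λ (n + 1)) =
      productOp (fun _ : Λ => spinRotation n (Pi.single 1 (Real.pi / 2))) * (siteSpin n x 2 * siteSpin n y 2) *
        (productOp (fun _ : Λ => spinRotation n (Pi.single 1 (Real.pi / 2))))ᴴ := by
    rw [productOp_conj_mul (fun _ => hu'), hVS x, hVS y]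
  have htr : ∀ (V M E : Op Λ (n + 1)), Vᴴ * V = 1 → E * V = V * E →
      (E * (V * M * Vᴴ)).trace = (E * M).trace := by
    intro V M E hVV' hEV'
    rw [show E * (V * M * Vᴴ) = (E * V) * M * Vᴴ by simp only [Matrix.mul_assoc], trace_mul_cycle,
      hEV', show Vᴴ * (V * E) * M = (Vᴴ * V) * (E * M) by simp only [Matrix.mul_assoc], hVV',
      Matrix.one_mul]
  rw [gibbsState_apply, gibbsState_apply, hprod, htr _ _ _ hVV hEV.eq]

/-- `a ↦ 𝟙 ⊗ a ⊗ 𝟙` is injective. [folklore] -/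
theorem onSite_injective (x : Λ) :
    Function.Injective (fun a : Matrix (Fin (n + 1)) (Fin (n + 1)) ℂ => (onSite x a : Op Λ (n + 1))) := by
  intro a b h
  ext k l
  have h1 := congrFun (congrFun h (Function.update (fun _ => 0) x k)) (Function.update (fun _ => 0) x l)
  simp only [onSite_apply, Function.update_self] at h1
  rwa [if_pos (fun y hy => by rw [Function.update_of_ne hy, Function.update_of_ne hy]),
    if_pos (fun y hy => by rw [Function.update_of_ne hy, Function.update_of_ne hy])] at h1

/-- **`‖𝟙 ⊗ a ⊗ 𝟙‖ = ‖a‖`**: `a ↦ onSite x a` is an injective unital `*`-homomorphism of matrix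
C⋆-algebras, hence isometric. Bratteli–Robinson II §6.2.1. [folklore] -/
theorem norm_onSite (x : Λ) (a : Matrix (Fin (n + 1)) (Fin (n + 1)) ℂ) :
    ‖(onSite x a : Op Λ (n + 1))‖ = ‖a‖ := by
  letI : CStarAlgebra (Op Λ (n + 1)) := {}
  letI : CStarAlgebra (Matrix (Fin (n + 1)) (Fin (n + 1)) ℂ) := {}
  let f : Matrix (Fin (n + 1)) (Fin (n + 1)) ℂ →⋆ₐ[ℂ] Op Λ (n + 1) :=
    { toFun := fun a => onSite x a
      map_one' := onSite_one' x
      map_mul' := fun a b => (onSite_mul x a b).symm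
      map_zero' := onSite_zero x
      map_add' := onSite_add' x
      commutes' := fun c => by
        simp only [Algebra.algebraMap_eq_smul_one, onSite_smul', onSite_one']
      map_star' := fun a => onSite_conjTranspose x a }
  exact NonUnitalStarAlgHom.norm_map f (onSite_injective x) a


end SpinAlgebra

/-! ### Assembly: uniform power-law decay of the spin–spin correlation, and the discharge -/

section Assembly

open Literature.Probability.LatticeModels HigherDimLSM

/-- If `a ≤ c e^{-t}` for every real `t`, then `a ≤ 0`. [folklore] -/
theorem nonpos_of_forall_le_mul_exp_neg {a c : ℝ} (h : ∀ t : ℝ, a ≤ c * Real.exp (-t)) : a ≤ 0 := by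
  by_contra ha
  push Not at ha
  have hc : 0 < c := by
    have h0 := h 0
    rw [neg_zero, Real.exp_zero, mul_one] at h0
    linarith
  have h2 : c / a < Real.exp (c / a) := by
    have := Real.add_one_le_exp (c / a)
    linarith
  have h3 : c * Real.exp (-(c / a)) < a := by
    rw [Real.exp_neg, ← div_eq_mul_inv, div_lt_iff₀ (Real.exp_pos _)]
    calc c = a * (c / a) := by field_simp
      _ < a * Real.exp (c / a) := mul_lt_mul_of_pos_left h2 ha
  linarith [h (c / a)]

variable {d : ℕ}

/-- **Uniform power-law decay of the spin–spin correlation** of the torus Gibbs state of a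
Hermitian, finite-range, bounded, rotation-invariant interaction of quantum spins in `d ∈ {1, 2}`
at `β > 0`: `|Σ_α ⟨Ŝ^α_x Ŝ^α_y⟩_{β,L}| ≤ C' (dist (x, y) + 1)^{-f}` with `f > 0` and `C'` independent
of `L`, `x`, `y`. The four raising/lowering correlations `⟨Ŝ^ε_x Ŝ^{ε'}_y⟩` are gauge
eigen-operators (eigenvalues `e^{εψ_x + ε'ψ_y}`): the mixed ones decay by the McBryan–Spencer
profile, the equal-sign ones vanish (constant profiles); `⟨Ŝˣ Ŝˣ⟩`, `⟨Ŝʸ Ŝʸ⟩` are combinations of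
the four and `⟨Ŝᶻ Ŝᶻ⟩ = ⟨Ŝˣ Ŝˣ⟩` by `SU(2)` symmetry. Koma–Tasaki, PRL 68 (1992) 3248, Theorem
eq. (4) and note [11] (quantum spin systems invariant under rotations about the `z`-axis);
K. R. Ito, J. Stat. Phys. 29 (1982) 747. [cite: KomaTasakiPRL1992, Theorem eq. (4) and note [11]] -/
theorem exists_abs_spinSpinCorrTorusOf_le_rpow (hd : 0 < d) (hd2 : d ≤ 2) (n : ℕ)
    {Φ : LatticeInteraction d (n + 1)} {R C : ℝ} (hΦh : Φ.IsHermitian) (hΦR : Φ.HasFiniteRange R)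
    (hΦC : Φ.IsBounded C) (hΦrot : Φ.IsRotationInvariant) {β : ℝ} (hβ : 0 < β) :
    ∃ f : ℝ, 0 < f ∧ ∃ C' : ℝ, ∀ (L : ℕ) [NeZero L] (x y : TorusSite d L),
      |spinSpinCorrTorusOf β Φ L x y| ≤ C' * ((torusDist x y : ℝ) + 1) ^ (-f) := by
  -- the constants
  set ρ : ℕ := ⌊R⌋₊ with hρ
  set m : ℕ := n * (2 * ⌊R⌋₊ + 1) ^ d with hm
  set K : ℝ := ((n + 1 : ℝ) ^ ((2 * ⌊R⌋₊ + 1) ^ d)) ^ 2 * C * (2 ^ d * 2 ^ ((2 * ⌊R⌋₊ + 1) ^ d))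
    with hK
  have hC0 : 0 ≤ C := (norm_nonneg _).trans (hΦC ∅)
  have hK0 : 0 ≤ K := by positivity
  have hb0 : 0 ≤ β * K := mul_nonneg hβ.le hK0
  set s₀ : ℝ := ‖spinRaise n‖ with hs₀
  have hA₀ : 0 ≤ s₀ * s₀ := mul_self_nonneg _
  set f : ℝ := 1 / (2 * (2 * (β * K) * (16 * (2 * ρ + 1) ^ d * (m * ρ) ^ 2) + m * ρ + 1)) with hf
  have hf0 : 0 < f := by positivity
  refine ⟨f, hf0, 3 * (s₀ * s₀ * Real.exp 1), fun L _ x y => ?_⟩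
  set B : ℝ := s₀ * s₀ * Real.exp 1 * ((torusDist x y : ℝ) + 1) ^ (-f) with hB
  have hB0 : 0 ≤ B := by positivity
  -- the generic gauge bound on this torus
  have hgauge : ∀ (ψ : TorusSite d L → ℝ) (A : Op (TorusSite d L) (n + 1)) (a : ℂ),
      ((Matrix.diagonal fun σ : TensorIndex _ (n + 1) =>
      ((Real.exp (-(∑ u, (ψ) u * ((σ u : ℕ) : ℝ))) : ℝ) : ℂ)) : Op (TorusSite d L) (n + 1)) * A * (Matrix.diagonal fun σ : TensorIndex _ (n + 1) =>
      ((Real.exp (-(∑ u, (-ψ) u * ((σ u : ℕ) : ℝ))) : ℝ) : ℂ)) = a • A →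
      ‖gibbsState β (torusHamiltonian Φ L) A‖ ≤ ‖a‖ * ‖A‖ * Real.exp (β * (K *
        ∑ u, ∑ v, if torusDist u v ≤ ρ then (Real.cosh (m * (ψ u - ψ v)) - 1) else 0)) :=
    fun ψ A a hA =>
      norm_gibbsState_rectTorusHamiltonian_le (Ls := fun _ : Fin d => L) hΦh hΦR hΦC hΦrot hβ.le ψ A a hA
  -- energies of negated and of constant profiles
  have hEneg : ∀ ψ : TorusSite d L → ℝ,
      (∑ u, ∑ v, if torusDist u v ≤ ρ then (Real.cosh (m * ((-ψ) u - (-ψ) v)) - 1) else 0) =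
        ∑ u, ∑ v, if torusDist u v ≤ ρ then (Real.cosh (m * (ψ u - ψ v)) - 1) else 0 := by
    intro ψ
    refine sum_congr rfl fun u _ => sum_congr rfl fun v _ => ?_
    rw [Pi.neg_apply, Pi.neg_apply, show (m : ℝ) * (-ψ u - -ψ v) = -(m * (ψ u - ψ v)) by ring,
      Real.cosh_neg]
  have hEconst : ∀ t : ℝ,
      (∑ u : TorusSite d L, ∑ v : TorusSite d L,
        if torusDist u v ≤ ρ then (Real.cosh (m * (t - t)) - 1) else 0) = 0 := by
    intro t
    refine sum_eq_zero fun u _ => sum_eq_zero fun v _ => ?_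
    rw [sub_self, mul_zero, Real.cosh_zero, sub_self, ite_self]
  -- norms of the observables
  have hnP : ∀ z : TorusSite d L, ‖(onSite z (spinRaise n) : Op (TorusSite d L) (n + 1))‖ = s₀ :=
    fun z => norm_onSite z _
  have hnM : ∀ z : TorusSite d L, ‖(onSite z (spinLower n) : Op (TorusSite d L) (n + 1))‖ = s₀ := by
    intro z
    rw [norm_onSite, spinLower_eq_conjTranspose, l2_opNorm_conjTranspose]
  have hnorm : ∀ (A A' : Op (TorusSite d L) (n + 1)), ‖A‖ = s₀ → ‖A'‖ = s₀ → ‖A * A'‖ ≤ s₀ * s₀ := by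
    intro A A' hA hA'
    calc ‖A * A'‖ ≤ ‖A‖ * ‖A'‖ := l2_opNorm_mul _ _
      _ = s₀ * s₀ := by rw [hA, hA']
  have helper : ∀ {a A c s : ℝ}, A ≤ s → 0 ≤ a → 0 ≤ c → a * A * c ≤ s * a * c := by
    intro a A c s h ha hc
    calc a * A * c = A * (a * c) := by ring
      _ ≤ s * (a * c) := mul_le_mul_of_nonneg_right h (mul_nonneg ha hc)
      _ = s * a * c := by ring
  -- the four raising/lowering correlations
  have hPM : ‖gibbsState β (torusHamiltonian Φ L) (onSite x (spinRaise n) * onSite y (spinLower n))‖ ≤ B := by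
    refine le_rpow_of_forall_testFunction_range hd hd2 x y ρ m hb0 hA₀ fun ψ => ?_
    have hev := gauge_conj_mul (-ψ) (gauge_conj_spinRaise (n := n) (-ψ) x) (gauge_conj_spinLower (n := n) (-ψ) y)
    refine (hgauge (-ψ) _ _ hev).trans ?_
    rw [hEneg, norm_mul, Complex.norm_real, Complex.norm_real, Real.norm_eq_abs, Real.norm_eq_abs,
      abs_of_pos (Real.exp_pos _), abs_of_pos (Real.exp_pos _), ← Real.exp_add, Pi.neg_apply,
      Pi.neg_apply, neg_neg, show -ψ x + ψ y = -(ψ x - ψ y) by ring, mul_assoc β K]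
    exact helper (hnorm _ _ (hnP x) (hnM y)) (Real.exp_pos _).le (Real.exp_pos _).le
  have hMP : ‖gibbsState β (torusHamiltonian Φ L) (onSite x (spinLower n) * onSite y (spinRaise n))‖ ≤ B := by
    refine le_rpow_of_forall_testFunction_range hd hd2 x y ρ m hb0 hA₀ fun ψ => ?_
    have hev := gauge_conj_mul ψ (gauge_conj_spinLower (n := n) ψ x) (gauge_conj_spinRaise (n := n) ψ y)
    refine (hgauge ψ _ _ hev).trans ?_
    rw [norm_mul, Complex.norm_real, Complex.norm_real, Real.norm_eq_abs, Real.norm_eq_abs,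
      abs_of_pos (Real.exp_pos _), abs_of_pos (Real.exp_pos _), ← Real.exp_add,
      show -ψ x + ψ y = -(ψ x - ψ y) by ring, mul_assoc β K]
    exact helper (hnorm _ _ (hnM x) (hnP y)) (Real.exp_pos _).le (Real.exp_pos _).le
  have hPP : ‖gibbsState β (torusHamiltonian Φ L) (onSite x (spinRaise n) * onSite y (spinRaise n))‖ ≤ B := by
    refine le_trans ?_ hB0
    refine nonpos_of_forall_le_mul_exp_neg (c := s₀ * s₀) fun t => ?_
    have hev := gauge_conj_mul (fun _ => -(t / 2)) (gauge_conj_spinRaise (n := n) (fun _ => -(t / 2)) x)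
      (gauge_conj_spinRaise (n := n) (fun _ : TorusSite d L => -(t / 2)) y)
    refine (hgauge _ _ _ hev).trans ?_
    rw [hEconst, mul_zero, mul_zero, Real.exp_zero, mul_one, norm_mul, Complex.norm_real,
      Real.norm_eq_abs, abs_of_pos (Real.exp_pos _), ← Real.exp_add,
      show -(t / 2) + -(t / 2) = -t by ring]
    nlinarith [hnorm _ _ (hnP x) (hnP y), Real.exp_pos (-t)]
  have hMM : ‖gibbsState β (torusHamiltonian Φ L) (onSite x (spinLower n) * onSite y (spinLower n))‖ ≤ B := by
    refine le_trans ?_ hB0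
    refine nonpos_of_forall_le_mul_exp_neg (c := s₀ * s₀) fun t => ?_
    have hev := gauge_conj_mul (fun _ => t / 2) (gauge_conj_spinLower (n := n) (fun _ => t / 2) x)
      (gauge_conj_spinLower (n := n) (fun _ : TorusSite d L => t / 2) y)
    refine (hgauge _ _ _ hev).trans ?_
    rw [hEconst, mul_zero, mul_zero, Real.exp_zero, mul_one, norm_mul, Complex.norm_real,
      Real.norm_eq_abs, abs_of_pos (Real.exp_pos _), ← Real.exp_add,
      show -(t / 2) + -(t / 2) = -t by ring]
    nlinarith [hnorm _ _ (hnM x) (hnM y), Real.exp_pos (-t)]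
  -- the three spin components
  have hsum4 : (1 / 4 : ℝ) *
      (‖gibbsState β (torusHamiltonian Φ L) (onSite x (spinRaise n) * onSite y (spinRaise n))‖ +
        ‖gibbsState β (torusHamiltonian Φ L) (onSite x (spinRaise n) * onSite y (spinLower n))‖ +
        ‖gibbsState β (torusHamiltonian Φ L) (onSite x (spinLower n) * onSite y (spinRaise n))‖ +
        ‖gibbsState β (torusHamiltonian Φ L) (onSite x (spinLower n) * onSite y (spinLower n))‖) ≤ B := by
    linarith
  have h0 : ‖gibbsState β (torusHamiltonian Φ L) (siteSpin n x 0 * siteSpin n y 0)‖ ≤ B :=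
    (norm_map_siteSpin_zero_mul_le _ x y).trans hsum4
  have h1 : ‖gibbsState β (torusHamiltonian Φ L) (siteSpin n x 1 * siteSpin n y 1)‖ ≤ B :=
    (norm_map_siteSpin_one_mul_le _ x y).trans hsum4
  have hHS : ∀ α, Commute (torusHamiltonian Φ L) (totalSpin (Λ := TorusSite d L) n α) := fun α =>
    commute_rectTorusHamiltonian_totalSpin hΦrot (fun _ : Fin d => L) α
  have h2 : ‖gibbsState β (torusHamiltonian Φ L) (siteSpin n x 2 * siteSpin n y 2)‖ ≤ B := by
    rw [gibbsState_siteSpin_two_mul_eq hHS]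
    exact h0
  -- assemble
  rw [spinSpinCorrTorusOf, dif_neg (NeZero.ne L)]
  show |(∑ α : Fin 3, thermalCorr β (torusHamiltonian Φ L) (siteSpin n x α) (siteSpin n y α)).re| ≤ _
  refine (Complex.abs_re_le_norm _).trans ((norm_sum_le _ _).trans ?_)
  rw [Fin.sum_univ_three]
  simp only [Matrix.thermalCorr]
  linarith

end Assembly


end Literature.MathematicalPhysics.QuantumLattice.MerminWagner

namespace Literature.MathematicalPhysics.QuantumLattice

open MerminWagner Literature.Probability.LatticeModels

/-- **hubbard.S12, general interactions** — DISCHARGE of the named fact `mermin_wagner_general`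
of `HeisenbergOrder.lean`: for `d ∈ {1, 2}`, `β > 0` and any Hermitian, bounded, finite-range,
`SU(2)`-invariant interaction of quantum spins `S = n/2`, the torus Gibbs states have no
long-range order of `⟨𝐒_x · 𝐒_y⟩` (`¬ HasTorusLRO`), by the uniform power-law decay
`exists_abs_spinSpinCorrTorusOf_le_rpow` (Koma–Tasaki / Ito, McBryan–Spencer method for quantum
spin systems) and the summation lemma `not_hasTorusLRO_of_abs_le_rpow`.
Koma–Tasaki, PRL 68 (1992) 3248, Theorem eq. (4), note [11] and the remark after the Theorem
("the above bounds rigorously rule out ... the corresponding magnetic ordering");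
Klein–Landau–Shucker, J. Stat. Phys. 26 (1981) 505 (the infinite-volume statement).
[cite: KomaTasakiPRL1992, Theorem eq. (4), note [11] and remark after the Theorem]
[cite: KleinLandauShuckerJSP1981, main Theorem] -/
theorem mermin_wagner_general_holds : mermin_wagner_general := by
  intro d hd1 hd n Φ R C hΦh hΦR hΦC hΦrot β hβ
  obtain ⟨f, hf, C', hC'⟩ :=
    exists_abs_spinSpinCorrTorusOf_le_rpow (d := d) hd1 hd n hΦh hΦR hΦC hΦrot hβ
  exact not_hasTorusLRO_of_abs_le_rpow (by omega) hf fun L _ x y => hC' L x y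


end Literature.MathematicalPhysics.QuantumLattice
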